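import Literature.AlgebraicGeometry.Motives.FiniteQuotientBaseChange
import Literature.AlgebraicGeometry.Motives.FiniteQuotientFunctor
import Literature.AlgebraicGeometry.Motives.BijectiveMorphismIso
import Literature.AlgebraicGeometry.Motives.BaseChangeProofs
import Literature.AlgebraicGeometry.Morphisms.ClopenPieceOfCoproduct
import Mathlib.AlgebraicGeometry.Morphisms.FlatDescent
import HarnessLib

/-!
# Recognising a morphism as the quotient by a finite group: comparison with `Y/Δ` after base change to `ℂ`

Topic `AlgebraicGeometry/Motives`, namespace `Literature.AlgebraicGeometry.Motives`.  PROOF FILE (theorems only; no definition,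
no named fact, no instance, no `sorry`) over the tree's finite-group quotient `Motives.finiteQuotient` ∕ `Motives.autQuotient`
([MumfordAV1970] §7 Thm. p. 66; `Motives/FiniteQuotient`, `Motives/FiniteQuotientFunctor`) and the predicate `Motives.IsSepQuotient`
(`Motives/SeparatedQuotient`).

The problem: given a projective `k`-scheme `Y`, a finite group `Δ → Aut_k(Y)` and a `Δ`-invariant `p : Y → Z` to a separated
`k`-scheme, decide that `p` IS the quotient (`IsSepQuotient`).  The tree answers «compare with `π : Y → Y/Δ`»: `p = π ≫ r` for a unique
`r : Y/Δ → Z` (`autQuotient.desc`), and `p` is the quotient iff `r` is an isomorphism (`isSepQuotient_of_isIso_desc`).  This file supplies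
the two standard reductions used to prove `IsIso r` for Shimura varieties ([Deligne1979] 2.7.1 (c) `(K/L)\S_L ⥲ S_K`, [Milne2005] Rem. 5.29 (c)):

* `isIso_of_isIso_baseChangeHom_map` — **an `L`-morphism that becomes an isomorphism after extension of the base field is an
  isomorphism**: fpqc descent of the property «isomorphism» (Mathlib `descendsAlong_isomorphisms_surjective_inf_flat_inf_quasicompact`,
  [StacksProject, Tag 02L4]) along the faithfully flat quasi-compact projection `Z ⊗_k K → Z`, of which `r ⊗_k K` is the base change
  ([GortzWedhorn2020] Prop. 4.16 / Prop. 14.51).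
* `isReduced_finiteQuotient_left`, `isReduced_autQuotient_left` — `Y/Δ` is reduced for `Y` reduced (`𝒪_{Y/Δ} ↪ π_*𝒪_Y`,
  [MumfordAV1970] §7 Thm. (2)); `exists_iso_finiteQuotient_baseChangeHom` — over `ℂ`, `(Y/Δ)_ℂ ≅ Y_ℂ/Δ` under `Y_ℂ` (quotients commute with
  base change, `isSepQuotient_baseChangeHom_of_isProjectiveOver`, [SGA1] V Prop. 1.9), whence `isReduced_baseChangeHom_autQuotient_left`
  and `map_baseChangeHom_autQuotientMk_surjective` (every complex point of `(Y/Δ)_ℂ` comes from one of `Y_ℂ`, [SGA1] V Prop. 1.1).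
* `isIso_of_bijective_of_isColimit_cofan` — **a `ℂ`-morphism `r : Q → M`, `Q` proper and reduced, `M` separated and the coproduct of smooth
  projective (integral) pieces, which is bijective on complex points is an isomorphism**: piece by piece this is the Zariski-Main-Theorem
  form `isIso_of_bijective_of_smooth` ([Springer1998] Thm. 5.2.8, `Motives/BijectiveMorphismIso`) for the pulled-back pieces of `Q`, and
  «isomorphism» is Zariski-local on the target (Mathlib `IsZariskiLocalAtTarget`).
* `isSepQuotient_of_isIso_desc` — `p = π ≫ r` with `r` an isomorphism ⇒ `p` is a separated quotient (`IsSepQuotient.of_comp_iso`).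

Use (cell `hodgecm-mathlib`, row VI-6 `levelQuotient_printed`): `Y = M_N`, `Z = M_K` the levels of Deligne's canonical model of a compact
unitary Shimura surface, `Δ = K/N` acting by Hecke translates, `p` the transition morphism; bijectivity of `r_ℂ` on complex points is the
double-coset bookkeeping `Sh_K(ℂ) = Sh_N(ℂ)/(K/N)`, and the pieces of `(M_K)_ℂ` are the ball quotients `Γ_g \ 𝔹²`.  Nothing Shimura-specific
is proved here.

## References
* [MumfordAV1970] D. Mumford, *Abelian Varieties* (1970), §7 Thm. p. 66 and Remark.
* [SGA1] A. Grothendieck, *SGA 1*, Exp. V, Prop. 1.1, Prop. 1.9.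
* [StacksProject] Tag 02L4 (fpqc descent of isomorphisms).
* [GortzWedhorn2020] U. Görtz, T. Wedhorn, *Algebraic Geometry I* (2nd ed.), Prop. 4.16, Prop. 14.51, §(3.5) Example 3.11.
* [Springer1998] T. A. Springer, *Linear Algebraic Groups* (2nd ed.), Thm. 5.2.8.
-/

set_option autoImplicit false

noncomputable section

open CategoryTheory CategoryTheory.Limits AlgebraicGeometry
open Literature.AlgebraicGeometry.RelativeSpec

namespace Literature.AlgebraicGeometry.Motives

universe u

/-! ## §1 Descent of «isomorphism» along extension of the base field -/

section Descent

variable {k K : Type u} [Field k] [Field K] (σ : k →+* K) {X Y : SchemeOver k}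

/-- **`f_σ : X_σ → Y_σ` is the base change of `f : X → Y` along `Y_σ → Y`**: the square formed by `f_σ`, `f` and the two projections
`X_σ → X`, `Y_σ → Y` is cartesian (pasting of the squares defining `X_σ`, `Y_σ`; same statement as the tree's
`GaloisDescent.isPullback_bcFunctor_map_left` and `Motives/CyclesBaseChange`'s, re-proved to keep the imports light). [cite: GortzWedhorn2020, Prop. 4.16] -/
private theorem isPullback_baseChangeHom_map_left' (f : X ⟶ Y) :
    IsPullback ((baseChangeHom σ).map f).left (pullback.fst X.hom (Spec.map (CommRingCat.ofHom σ)))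
      (pullback.fst Y.hom (Spec.map (CommRingCat.ofHom σ))) f.left := by
  refine IsPullback.of_right ?_ (baseChangeHom_map_left_comp_fst σ f)
    (IsPullback.of_hasPullback Y.hom (Spec.map (CommRingCat.ofHom σ))).flip
  have h2 : ((baseChangeHom σ).map f).left ≫ pullback.snd Y.hom (Spec.map (CommRingCat.ofHom σ)) =
      pullback.snd X.hom (Spec.map (CommRingCat.ofHom σ)) := pullback.lift_snd _ _ _
  rw [h2, Over.w f]
  exact (IsPullback.of_hasPullback X.hom (Spec.map (CommRingCat.ofHom σ))).flip

/-- The projection `Y_σ → Y` is surjective, flat and quasi-compact (base change of `Spec K → Spec k`, which is all three: one point onto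
one point, a field extension, affine). [cite: GortzWedhorn2020, Prop. 14.51 with Prop. 4.32] -/
theorem surjective_flat_quasiCompact_fst (Y : SchemeOver k) :
    (@Surjective ⊓ @Flat ⊓ @QuasiCompact : MorphismProperty Scheme.{u})
      (pullback.fst Y.hom (Spec.map (CommRingCat.ofHom σ))) := by
  haveI : Surjective (Spec.map (CommRingCat.ofHom σ)) :=
    ⟨fun x => ⟨IsLocalRing.closedPoint K, Subsingleton.elim (α := ↥(Spec (CommRingCat.of k))) _ _⟩⟩
  refine ⟨⟨?_, ?_⟩, ?_⟩
  · exact MorphismProperty.pullback_fst (P := @Surjective) _ _ inferInstance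
  · exact MorphismProperty.pullback_fst (P := @Flat) _ _ inferInstance
  · exact MorphismProperty.pullback_fst (P := @QuasiCompact) _ _ inferInstance

/-- **A `k`-morphism that becomes an isomorphism after extension of the base field `σ : k → K` is an isomorphism** — fpqc descent
of «isomorphism» ([StacksProject, Tag 02L4]; Mathlib `descendsAlong_isomorphisms_surjective_inf_flat_inf_quasicompact`) along the
surjective flat quasi-compact `Y_σ → Y`, of which `f_σ` is the base change. [cite: StacksProject, Tag 02L4] [cite: GortzWedhorn2020, Prop. 14.51] -/
theorem isIso_of_isIso_baseChangeHom_map (f : X ⟶ Y) [IsIso ((baseChangeHom σ).map f)] : IsIso f := by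
  have hl : (MorphismProperty.isomorphisms Scheme.{u}) ((baseChangeHom σ).map f).left :=
    (MorphismProperty.isomorphisms.iff _).2 (inferInstanceAs (IsIso ((Over.forget _).map ((baseChangeHom σ).map f))))
  have h := MorphismProperty.of_isPullback_of_descendsAlong (P := MorphismProperty.isomorphisms Scheme.{u})
    (Q := (@Surjective ⊓ @Flat ⊓ @QuasiCompact : MorphismProperty Scheme.{u}))
    (isPullback_baseChangeHom_map_left' σ f) (surjective_flat_quasiCompact_fst σ Y) hl
  haveI : IsIso f.left := (MorphismProperty.isomorphisms.iff _).1 h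
  haveI : IsIso ((Over.forget _).map f) := inferInstanceAs (IsIso f.left)
  exact isIso_of_reflects_iso f (Over.forget _)

end Descent

/-! ## §2 `Y/Δ` is reduced; `(Y/Δ)_ℂ ≅ Y_ℂ/Δ` and its consequences -/

section Reduced

variable {k : Type u} [Field k] {X : SchemeOver k} {G : Type*} [Group G] [Finite G]

/-- **`X/G` is reduced for `X` reduced**: `𝒪_{X/G} → π_*𝒪_X` is injective (the quotient map is schematically dominant, [MumfordAV1970] §7
Thm. (2) `𝒪_Y = π_*(𝒪_X)^G`; tree `IsGeometricQuotient.app_injective`), and a subring of a reduced ring is reduced.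
[cite: MumfordAV1970, §7 Thm. p. 66 (2)] -/
theorem isReduced_finiteQuotient_left (ρ : ActionOver X.hom G) [IsSeparated X.hom]
    (hcov : ∀ x : X.left, ∃ O : ρ.StableAffineOpens, x ∈ O.1) [IsReduced X.left] :
    IsReduced (finiteQuotient ρ).left := by
  have hgq := ρ.isGeometricQuotient_gluedMk hcov
  change IsReduced ρ.glued
  refine ⟨fun W => ?_⟩
  haveI : _root_.IsReduced Γ(X.left, (ρ.gluedMk hcov) ⁻¹ᵁ W) := IsReduced.component_reduced _
  exact isReduced_of_injective ((ρ.gluedMk hcov).app W).hom (hgq.app_injective W)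

/-- `Y/Δ` (`Motives.autQuotient`) is reduced for `Y` projective and reduced. [cite: MumfordAV1970, §7 Thm. p. 66 (2)] -/
theorem isReduced_autQuotient_left {Y : SchemeOver k} {Δ : Type*} [Group Δ] [Finite Δ] (ρ : Δ →* Aut Y)
    (hY : IsProjectiveOver Y) [IsReduced Y.left] : IsReduced (autQuotient ρ hY).left := by
  haveI := hY.isSeparated
  exact isReduced_finiteQuotient_left (autActionOver ρ) (autActionOver_cover ρ hY)

end Reduced

section ComplexBaseChange

variable {L : Type} [Field L] (τ : L →+* ℂ) {Δ : Type} [Group Δ] [Fintype Δ] {Y : SchemeOver L}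
  (hY : IsProjectiveOver Y) (act : Δ →* Aut Y)

/-- `Y ⊗_{L,τ} ℂ` is projective over `ℂ` for `Y` projective over `L` (tree `IsProjectiveOver.baseChange_obj` along `τ`).
[cite: Liu2002, Prop. 3.1.23 and Ex. 3.1.10] -/
theorem IsProjectiveOver.baseChangeHom_obj (τ : L →+* ℂ) {Y : SchemeOver L} (hY : IsProjectiveOver Y) :
    IsProjectiveOver ((baseChangeHom τ).obj Y) := by
  letI : Algebra L ℂ := τ.toAlgebra
  exact hY.baseChange_obj (L := ℂ)

/-- `Y ⊗_{L,τ} ℂ → Spec ℂ` is separated for `Y` projective over `L`. [cite: Liu2002, Prop. 3.1.23] -/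
theorem isSeparated_baseChangeHom_hom_of_isProjectiveOver (τ : L →+* ℂ) {Y : SchemeOver L} (hY : IsProjectiveOver Y) :
    IsSeparated ((baseChangeHom τ).obj Y).hom := by
  haveI := (IsProjectiveOver.baseChangeHom_obj τ hY).isProper
  infer_instance

/-- **`(Y/Δ) ⊗_L ℂ ≅ (Y ⊗_L ℂ)/Δ` under `Y ⊗_L ℂ`** (finite-group quotients of projective schemes commute with extension of the base field,
[SGA1] V Prop. 1.9: the tree's `isSepQuotient_baseChangeHom_of_isProjectiveOver` says `π ⊗ ℂ` is a separated quotient, and a separated quotient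
of the projective `Y ⊗ ℂ` is Mumford's `finiteQuotient`, `isoFiniteQuotient_of_isSepQuotient`). [cite: SGA1, Exp. V Prop. 1.9]
[cite: MumfordAV1970, §7 Thm. p. 66 (Remark)] -/
theorem exists_iso_finiteQuotient_baseChangeHom :
    letI : IsSeparated ((baseChangeHom τ).obj Y).hom := isSeparated_baseChangeHom_hom_of_isProjectiveOver τ hY
    ∃ i : (baseChangeHom τ).obj (autQuotient act hY) ≅
        finiteQuotient (⟨((Over.forget _).mapAut ((baseChangeHom τ).obj Y)).comp (((baseChangeHom τ).mapAut Y).comp act),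
          fun g => Over.w ((((baseChangeHom τ).mapAut Y).comp act) g).hom⟩ : ActionOver ((baseChangeHom τ).obj Y).hom Δ),
      (baseChangeHom τ).map (autQuotient.mk act hY) ≫ i.hom = finiteQuotient.mk _
        (ActionOver.forall_exists_stableAffineOpen_of_isProjectiveOver _ (IsProjectiveOver.baseChangeHom_obj τ hY)) := by
  obtain ⟨hZ, hq⟩ := isSepQuotient_baseChangeHom_of_isProjectiveOver L τ Δ Y (autQuotient act hY) hY act
    (autQuotient.mk act hY) (autQuotient.isSeparated_hom act hY) (autQuotient.isSepQuotient act hY)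
  exact isoFiniteQuotient_of_isSepQuotient (IsProjectiveOver.baseChangeHom_obj τ hY)
    (((baseChangeHom τ).mapAut Y).comp act) _ hZ hq

/-- **`(Y/Δ) ⊗_L ℂ` is reduced when `Y ⊗_L ℂ` is** (it is `(Y ⊗_L ℂ)/Δ`, `exists_iso_finiteQuotient_baseChangeHom`, `isReduced_finiteQuotient_left`).
[cite: SGA1, Exp. V Prop. 1.9] [cite: MumfordAV1970, §7 Thm. p. 66 (2)] -/
theorem isReduced_baseChangeHom_autQuotient_left [IsReduced ((baseChangeHom τ).obj Y).left] :
    IsReduced ((baseChangeHom τ).obj (autQuotient act hY)).left := by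
  haveI : IsSeparated ((baseChangeHom τ).obj Y).hom := isSeparated_baseChangeHom_hom_of_isProjectiveOver τ hY
  obtain ⟨i, -⟩ := exists_iso_finiteQuotient_baseChangeHom τ hY act
  haveI := isReduced_finiteQuotient_left _
    (ActionOver.forall_exists_stableAffineOpen_of_isProjectiveOver
      (⟨((Over.forget _).mapAut ((baseChangeHom τ).obj Y)).comp (((baseChangeHom τ).mapAut Y).comp act),
        fun g => Over.w ((((baseChangeHom τ).mapAut Y).comp act) g).hom⟩ : ActionOver ((baseChangeHom τ).obj Y).hom Δ)
      (IsProjectiveOver.baseChangeHom_obj τ hY))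
  haveI : IsIso i.hom.left := inferInstanceAs (IsIso ((Over.forget _).map i.hom))
  exact isReduced_of_isOpenImmersion i.hom.left

/-- **Every complex point of `(Y/Δ) ⊗_L ℂ` is the image of a complex point of `Y ⊗_L ℂ`** under `π ⊗ ℂ` (`(Y/Δ)_ℂ = Y_ℂ/Δ` and
[SGA1] V Prop. 1.1: `π(ℂ)` is onto, tree `map_mk_surjective`). [cite: SGA1, Exp. V Prop. 1.1 and Prop. 1.9] -/
theorem map_baseChangeHom_autQuotientMk_surjective [LocallyOfFiniteType ((baseChangeHom τ).obj Y).hom] :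
    Function.Surjective (AlgPoints.map (L := ℂ) ((baseChangeHom τ).map (autQuotient.mk act hY))) := by
  haveI : IsSeparated ((baseChangeHom τ).obj Y).hom := isSeparated_baseChangeHom_hom_of_isProjectiveOver τ hY
  obtain ⟨i, hi⟩ := exists_iso_finiteQuotient_baseChangeHom τ hY act
  intro y
  obtain ⟨x, hx⟩ := map_mk_surjective _ _ (AlgPoints.map i.hom y)
  refine ⟨x, ?_⟩
  rw [← hi, AlgPoints.map_comp_apply] at hx
  simpa only [AlgPoints.map_apply, Category.assoc, Iso.hom_inv_id, Category.comp_id] using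
    congrArg (AlgPoints.map i.inv) hx

end ComplexBaseChange

/-! ## §3 A bijective morphism onto a coproduct of smooth projective varieties over `ℂ` is an isomorphism -/

section Pieces

variable {Q M : SchemeOver ℂ} (r : Q ⟶ M) {κ : Type} {X : κ → SchemeOver ℂ} (ι : ∀ q, X q ⟶ M)

/-- **A `ℂ`-morphism `r : Q → M = ∐_q X_q`, `Q` proper and reduced, `M` separated, `X_q` smooth projective (integral), bijective on complex
points, is an isomorphism.**  Over each piece, the base change `Q ×_M X_q → X_q` of `r` is a morphism from a proper (closed in `Q` over the
proper… precisely: base change of the proper `r`, composed with the proper `X_q → Spec ℂ`) reduced (open in `Q`) `ℂ`-scheme to a smooth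
projective variety, bijective on complex points (the complex points of `Q ×_M X_q` are the pairs `(a, x)` with `r a = ι_q x`), hence an
isomorphism by the Zariski-Main-Theorem form `isIso_of_bijective_of_smooth` ([Springer1998] Thm. 5.2.8); and «isomorphism» is Zariski-local
on `M`, which the open immersions `ι_q` cover (Mathlib `IsZariskiLocalAtTarget.of_openCover`). [cite: Springer1998, Thm. 5.2.8 (p. 85)]
[cite: GortzWedhorn2020, §(3.5) Example 3.11] -/
theorem isIso_of_bijective_of_isColimit_cofan [IsProper Q.hom] [IsReduced Q.left] [IsSeparated M.hom]
    (n : κ → ℕ) (hX : ∀ q, IsSmoothProjective (n q) (X q)) (hcol : IsColimit (Cofan.mk M ι))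
    (hr : Function.Bijective (AlgPoints.map (L := ℂ) r)) : IsIso r := by
  obtain ⟨hcol'⟩ := Literature.AlgebraicGeometry.Morphisms.isColimit_cofan_left hcol
  haveI hιo : ∀ q, IsOpenImmersion (ι q).left := fun q =>
    Literature.AlgebraicGeometry.Morphisms.isOpenImmersion_of_isColimit_cofan hcol' q
  -- `r.left` is proper: `Q → Spec ℂ` is proper and `M → Spec ℂ` separated
  haveI : IsProper r.left := by
    have h : IsProper (r.left ≫ M.hom) := by rw [Over.w r]; infer_instance
    exact IsProper.of_comp (f := r.left) (g := M.hom)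
  -- the open cover of `M` by the pieces
  let 𝒰 : M.left.OpenCover := Scheme.Cover.mkOfCovers κ (fun q => (X q).left) (fun q => (ι q).left)
    (fun m => Literature.AlgebraicGeometry.Morphisms.exists_eq_of_isColimit_cofan hcol' m)
  -- over each piece the base change of `r` is an isomorphism
  have hpiece : ∀ q, IsIso (pullback.snd r.left (ι q).left) := by
    intro q
    -- the pulled-back piece `Q_q = Q ×_M X_q` over `ℂ` and `r_q : Q_q → X_q`
    let Qq : SchemeOver ℂ := Over.mk (pullback.snd r.left (ι q).left ≫ (X q).hom)
    let rq : Qq ⟶ X q := Over.homMk (pullback.snd r.left (ι q).left) rfl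
    haveI := (hX q).smoothOfRelativeDimension
    haveI : Smooth (X q).hom := SmoothOfRelativeDimension.smooth (n q) (X q).hom
    haveI : IsProper (X q).hom := IsSmoothProjective.isProper_holds (hX q)
    haveI : IsIntegral (X q).left := IsSmoothProjective.isIntegral_holds (hX q)
    haveI : IsProper Qq.hom := by
      change IsProper (pullback.snd r.left (ι q).left ≫ (X q).hom)
      infer_instance
    haveI : IsReduced Qq.left := by
      change IsReduced (pullback r.left (ι q).left)
      exact isReduced_of_isOpenImmersion (pullback.fst r.left (ι q).left)
    -- a map `Spec ℂ → Q ×_M X_q` over `X_q` gives a complex point of `Q`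
    have hw : ∀ l : Spec (CommRingCat.of ℂ) ⟶ pullback r.left (ι q).left,
        l ≫ pullback.snd r.left (ι q).left ≫ (X q).hom = (specOver ℂ ℂ).hom →
        (l ≫ pullback.fst r.left (ι q).left) ≫ Q.hom = (specOver ℂ ℂ).hom := by
      intro l hl
      rw [← Over.w r, Category.assoc, pullback.condition_assoc, Over.w (ι q)]
      exact hl
    have hbij : Function.Bijective (AlgPoints.map (L := ℂ) rq) := by
      constructor
      · intro x₁ x₂ h₁₂
        let l₁ : Spec (CommRingCat.of ℂ) ⟶ pullback r.left (ι q).left := x₁.left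
        let l₂ : Spec (CommRingCat.of ℂ) ⟶ pullback r.left (ι q).left := x₂.left
        have hsnd : l₁ ≫ pullback.snd r.left (ι q).left = l₂ ≫ pullback.snd r.left (ι q).left :=
          congrArg (fun P : AlgPoints (X q) ℂ => P.left) h₁₂
        have hfst : l₁ ≫ pullback.fst r.left (ι q).left = l₂ ≫ pullback.fst r.left (ι q).left := by
          have h := @hr.1 (Over.homMk (l₁ ≫ pullback.fst r.left (ι q).left) (hw l₁ (Over.w x₁)))
            (Over.homMk (l₂ ≫ pullback.fst r.left (ι q).left) (hw l₂ (Over.w x₂))) (Over.OverMorphism.ext (by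
              change (l₁ ≫ pullback.fst r.left (ι q).left) ≫ r.left = (l₂ ≫ pullback.fst r.left (ι q).left) ≫ r.left
              rw [Category.assoc, Category.assoc, pullback.condition, ← Category.assoc, ← Category.assoc, hsnd]))
          exact congrArg (fun P : AlgPoints Q ℂ => P.left) h
        exact Over.OverMorphism.ext (pullback.hom_ext hfst hsnd)
      · intro x
        obtain ⟨a, ha⟩ := hr.2 (AlgPoints.map (ι q) x)
        let la : Spec (CommRingCat.of ℂ) ⟶ Q.left := a.left
        let lx : Spec (CommRingCat.of ℂ) ⟶ (X q).left := x.left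
        have hax : la ≫ r.left = lx ≫ (ι q).left := congrArg (fun P : AlgPoints M ℂ => P.left) ha
        refine ⟨Over.homMk (pullback.lift la lx hax) ?_, ?_⟩
        · change pullback.lift la lx hax ≫ pullback.snd r.left (ι q).left ≫ (X q).hom = (specOver ℂ ℂ).hom
          rw [pullback.lift_snd_assoc]
          exact Over.w x
        · exact Over.OverMorphism.ext (pullback.lift_snd la lx hax)
    haveI : IsIso rq := isIso_of_bijective_of_smooth rq hbij
    exact inferInstanceAs (IsIso ((Over.forget _).map rq))
  -- «isomorphism» is Zariski-local on the target
  have hleft : (MorphismProperty.isomorphisms Scheme.{0}) r.left :=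
    IsZariskiLocalAtTarget.of_openCover 𝒰 fun q => (MorphismProperty.isomorphisms.iff _).2 (hpiece q)
  haveI : IsIso r.left := (MorphismProperty.isomorphisms.iff _).1 hleft
  haveI : IsIso ((Over.forget _).map r) := inferInstanceAs (IsIso r.left)
  exact isIso_of_reflects_iso r (Over.forget _)

end Pieces

/-! ## §4 `p = π ≫ r` with `r` an isomorphism ⇒ `p` is the quotient -/

section Compare

variable {k : Type u} [Field k] {Y Z : SchemeOver k} {Δ : Type*} [Group Δ] [Finite Δ]

/-- **If the comparison morphism `r : Y/Δ → Z` (`p = π ≫ r`) is an isomorphism, then `p` is a quotient of `Y` by `Δ` for separated test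
objects** (`π : Y → Y/Δ` is one, `autQuotient.isSepQuotient`, and `IsSepQuotient` is insensitive to isomorphisms of the target,
`IsSepQuotient.of_comp_iso`). [cite: MumfordAV1970, §7 Thm. p. 66 (Remark)] -/
theorem isSepQuotient_of_isIso_desc (hY : IsProjectiveOver Y) (act : Δ →* Aut Y) (p : Y ⟶ Z) (hZ : IsSeparated Z.hom)
    (hp : ∀ g : Δ, (act g).hom ≫ p = p) [IsIso (autQuotient.desc act hY p hZ hp)] :
    IsSepQuotient (fun g => act g) p := by
  have e : autQuotient.mk act hY = p ≫ inv (autQuotient.desc act hY p hZ hp) := by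
    rw [IsIso.eq_comp_inv, autQuotient.mk_desc]
  refine IsSepQuotient.of_comp_iso (asIso (autQuotient.desc act hY p hZ hp)).symm ?_
  rw [Iso.symm_hom, asIso_inv, ← e]
  exact autQuotient.isSepQuotient act hY

end Compare

end Literature.AlgebraicGeometry.Motives

end
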